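import Literature.NumberTheory.DiophantineGeometry.UnitEquationHeightInequality
import Literature.NumberTheory.DiophantineGeometry.UnitEquationLogEmbedding
import Mathlib.Analysis.Normed.Module.FiniteDimension
import HarnessLib

/-!
# Finiteness of the unit equation `u + v = 1` in `T`-units of a number field
# (Siegel–Mahler–Lang; Bombieri–Gubler Thm. 5.2.1, finiteness part, after Beukers–Schlickewei)

Bombieri–Gubler, *Heights in Diophantine Geometry*, Thm. 5.2.1 (Beukers–Schlickewei): *the
equation `x + y = 1`, `(x, y) ∈ Γ`, has at most `C₁ C₂ʳ` solutions for a subgroup `Γ` of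
`ℚ̄^× × ℚ̄^×` of finite rank `r`*; in particular (Siegel, Mahler, Lang; Silverman AEC
Thm. IX.4.1) **for a number field `F` and a finite set `T` of finite places, the equation
`u + v = 1` has only finitely many solutions in `T`-units `u, v ∈ R_T^×`**
(`finite_unitEquation`, in exactly the form `U` consumed by
`finite_integer_sq_eq_cubic_of_unitEquation` of `SiegelCubicReduction.lean`).

We formalise the *finiteness* (not the uniform bound) along B–G's proof of Thm. 5.2.1,
pp. 136–138, with two simplifications that the weaker goal permits:

1. the norm `‖u‖ = ĥ(x)` on `Γ/tors ≅ ℤʳ` (Cassels' argument, ¶5.2.16) is replaced by the sup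
   norm of the logarithmic embedding `Λ(x) = (L_T x₁, L_T x₂) ∈ ℝ^{M_F^∞ ⊔ T} × ℝ^{M_F^∞ ⊔ T}`
   (`UnitEquationLogEmbedding.lean`), which is comparable with `ĥ` up to constants; no `S`-unit
   theorem, no rank, no Minkowski;
2. instead of *counting* large solutions in a cone by the gap principle (5.13) and Lemma 5.2.19,
   and small ones by the uniform Zhang theorem 4.2.3, we only show they are *finitely many*:
   small solutions by **Northcott** (Mathlib `NumberField.finite_setOf_logHeight₁_le`), and large
   solutions in a narrow cone have bounded height by **Lemma 5.2.17** (`norm_le_of_cone`, from the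
   key inequality (5.12) = `key_height_inequality` of `UnitEquationHeightInequality.lean`), the
   finitely many cones coming from the compactness of the unit sphere.

Contents: `norm_le_of_cone` (B–G Lemma 5.2.17, abstract normed-space form) ·
`unitSol`, `unitLog`, `unitHt` (solutions, their embedding and height) · comparison and
Northcott lemmas · `norm_unitLog_le_gap` ((5.12)) · `finite_unitSol` · **`finite_unitEquation`**.

## References

* E. Bombieri, W. Gubler, *Heights in Diophantine Geometry*, CUP 2006, Thm. 5.2.1 and its proof,
  ¶5.2.16–5.2.18, Lemma 5.2.17 (pp. 127–138). [BombieriGubler2006]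
* J. H. Silverman, *The Arithmetic of Elliptic Curves*, 2nd ed., Thm. IX.4.1. [SilvermanAEC2009]
* F. Beukers, H. P. Schlickewei, Acta Arith. 78 (1996), 189–199.
-/

noncomputable section

open scoped Classical

open NumberField IsDedekindDomain Height Real

namespace Literature.NumberTheory.DiophantineGeometry

/-! ## Lemma 5.2.17 in a normed space -/

/-- **Bombieri–Gubler Lemma 5.2.17** (abstract form). In a real normed space let `u, v` satisfy
the inequality (5.12) `‖u‖ ≤ α + β/(n-1) · ‖v - 2n u‖` for all `n ≥ 2`, let the directions be
close, `‖v/‖v‖ - u/‖u‖‖ ≤ 1/(16β)`, and let `2α < ‖u‖ ≤ ‖v‖`. Then `‖v‖ ≤ 2(⌈8β⌉ + 2) ‖u‖`.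
(Printed with `ĥ`, `κ`, `ε = 1/10`, conclusion `‖v‖ ≤ 90‖u‖`: take `n = ⌊‖v‖/(2‖u‖)⌋`; if `n` is
large, (5.12) forces `‖u‖ ≤ 2α`.) [cite: BombieriGubler2006, Lemma 5.2.17] -/
theorem norm_le_of_cone {V : Type*} [NormedAddCommGroup V] [NormedSpace ℝ V] {α β : ℝ}
    (hα : 0 ≤ α) (hβ : 0 < β) {u v : V}
    (h512 : ∀ n : ℕ, 2 ≤ n → ‖u‖ ≤ α + β / (n - 1) * ‖v - (2 * n : ℝ) • u‖)
    (hdir : ‖‖v‖⁻¹ • v - ‖u‖⁻¹ • u‖ ≤ 1 / (16 * β)) (hlarge : 2 * α < ‖u‖) (huv : ‖u‖ ≤ ‖v‖) :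
    ‖v‖ ≤ 2 * (⌈8 * β⌉₊ + 2) * ‖u‖ := by
  have hu : 0 < ‖u‖ := by linarith
  have hv : 0 < ‖v‖ := by linarith
  set n := ⌊‖v‖ / (2 * ‖u‖)⌋₊ with hn
  have hq : 0 ≤ ‖v‖ / (2 * ‖u‖) := by positivity
  have hn1 : (n : ℝ) ≤ ‖v‖ / (2 * ‖u‖) := Nat.floor_le hq
  have hn2 : ‖v‖ / (2 * ‖u‖) < n + 1 := Nat.lt_floor_add_one _
  have hlow : 2 * n * ‖u‖ ≤ ‖v‖ := by
    have := mul_le_mul_of_nonneg_right hn1 (by positivity : (0 : ℝ) ≤ 2 * ‖u‖)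
    rw [div_mul_cancel₀ _ (by positivity)] at this; linarith [this]
  have hupp : ‖v‖ < 2 * (n + 1) * ‖u‖ := by
    have := mul_lt_mul_of_pos_right hn2 (by positivity : (0 : ℝ) < 2 * ‖u‖)
    rw [div_mul_cancel₀ _ (by positivity)] at this; linarith [this]
  -- it suffices to show `n + 1 ≤ ⌈8β⌉ + 2`
  suffices hsmall : (n : ℝ) + 1 ≤ ⌈8 * β⌉₊ + 2 by
    calc ‖v‖ ≤ 2 * (n + 1) * ‖u‖ := hupp.le
      _ ≤ 2 * (⌈8 * β⌉₊ + 2) * ‖u‖ := by gcongr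
  by_contra hbig
  rw [not_le] at hbig
  have hceil : 8 * β ≤ ⌈8 * β⌉₊ := Nat.le_ceil _
  have hbigN : ⌈8 * β⌉₊ + 2 ≤ n := by
    have : (⌈8 * β⌉₊ + 2 : ℕ) < n + 1 := by exact_mod_cast hbig
    omega
  have hbigR : (⌈8 * β⌉₊ : ℝ) + 2 ≤ n := by exact_mod_cast hbigN
  have hn8 : 8 * β + 1 ≤ (n : ℝ) - 1 := by linarith
  have hn2' : (2 : ℝ) ≤ n := by nlinarith
  have hn2nat : 2 ≤ n := by exact_mod_cast hn2'
  -- decompose `v - 2n u` along the directions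
  have hdecomp : v - (2 * n : ℝ) • u =
      (‖v‖ - 2 * n * ‖u‖) • (‖v‖⁻¹ • v) + (2 * n * ‖u‖) • (‖v‖⁻¹ • v - ‖u‖⁻¹ • u) := by
    rw [smul_sub, sub_smul, smul_smul, smul_smul, smul_smul, mul_inv_cancel₀ hv.ne', one_smul,
      show 2 * n * ‖u‖ * ‖u‖⁻¹ = 2 * n by field_simp]
    abel
  have hnormle : ‖v - (2 * n : ℝ) • u‖ ≤ 2 * ‖u‖ + 2 * n * ‖u‖ * (1 / (16 * β)) := by
    rw [hdecomp]
    refine (norm_add_le _ _).trans ?_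
    rw [norm_smul, norm_smul, norm_smul, norm_inv, norm_norm, inv_mul_cancel₀ hv.ne',
      Real.norm_of_nonneg (by linarith : 0 ≤ ‖v‖ - 2 * n * ‖u‖),
      Real.norm_of_nonneg (by positivity : (0 : ℝ) ≤ 2 * n * ‖u‖), mul_one]
    have : ‖v‖ - 2 * n * ‖u‖ ≤ 2 * ‖u‖ := by linarith
    gcongr
  -- feed into (5.12)
  have h := h512 n hn2nat
  have hn1' : (0 : ℝ) < n - 1 := by linarith
  have hcoef1 : β / (n - 1) * (2 * ‖u‖) ≤ ‖u‖ / 4 := by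
    rw [div_mul_eq_mul_div, div_le_div_iff₀ hn1' (by norm_num : (0 : ℝ) < 4)]
    nlinarith
  have hcoef2 : β / (n - 1) * (2 * n * ‖u‖ * (1 / (16 * β))) ≤ ‖u‖ / 4 := by
    rw [show β / (n - 1) * (2 * n * ‖u‖ * (1 / (16 * β))) = n / (8 * (n - 1)) * ‖u‖ by
      field_simp; ring]
    have : (n : ℝ) / (8 * (n - 1)) ≤ 1 / 4 := by
      rw [div_le_div_iff₀ (by positivity) (by norm_num : (0 : ℝ) < 4)]; nlinarith
    nlinarith
  have : ‖u‖ ≤ α + ‖u‖ / 2 := by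
    calc ‖u‖ ≤ α + β / (n - 1) * ‖v - (2 * n : ℝ) • u‖ := h
      _ ≤ α + β / (n - 1) * (2 * ‖u‖ + 2 * n * ‖u‖ * (1 / (16 * β))) := by gcongr
      _ = α + (β / (n - 1) * (2 * ‖u‖) + β / (n - 1) * (2 * n * ‖u‖ * (1 / (16 * β)))) := by
          ring
      _ ≤ α + (‖u‖ / 4 + ‖u‖ / 4) := by gcongr
      _ = α + ‖u‖ / 2 := by ring
  linarith

/-! ## Solutions of the unit equation, their embedding and height -/

variable (F : Type*) [Field F] [NumberField F] (T : Finset (HeightOneSpectrum (𝓞 F)))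

/-- The solutions of `u + v = 1` in `T`-units, as a subset of `Fˣ × Fˣ`.
[cite: BombieriGubler2006, Thm. 5.2.1] -/
def unitSol : Set (Fˣ × Fˣ) :=
  {x | x.1 ∈ (T : Set (HeightOneSpectrum (𝓞 F))).unit F ∧
    x.2 ∈ (T : Set (HeightOneSpectrum (𝓞 F))).unit F ∧ (x.1 : F) + x.2 = 1}

/-- The embedding `Λ(x) = (L_T x₁, L_T x₂)` of a pair of units (B–G ¶5.2.16, `u ∈ ℝʳ`).
[cite: BombieriGubler2006, 5.2.16] -/
def unitLog (x : Fˣ × Fˣ) : (InfinitePlace F ⊕ ↥T → ℝ) × (InfinitePlace F ⊕ ↥T → ℝ) :=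
  (logEmbedding T x.1, logEmbedding T x.2)

/-- The height `ĥ(x) = h(x₁) + h(x₂)` of a pair (B–G ¶5.2.16). [cite: BombieriGubler2006, 5.2.16] -/
def unitHt (x : Fˣ × Fˣ) : ℝ := logHeight₁ (x.1 : F) + logHeight₁ (x.2 : F)

variable {F T}

/-- `ĥ ≥ 0`. [folklore] -/
theorem unitHt_nonneg (x : Fˣ × Fˣ) : 0 ≤ unitHt F x :=
  add_nonneg (zero_le_logHeight₁ _) (zero_le_logHeight₁ _)

/-- `‖Λ x‖ ≤ 2 ĥ(x)`. [folklore] -/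
theorem norm_unitLog_le (x : Fˣ × Fˣ) : ‖unitLog F T x‖ ≤ 2 * unitHt F x := by
  simp only [unitLog, Prod.norm_def, unitHt]
  have h1 := norm_logEmbedding_le T x.1
  have h2 := norm_logEmbedding_le T x.2
  have := zero_le_logHeight₁ (x.1 : F)
  have := zero_le_logHeight₁ (x.2 : F)
  exact max_le (by linarith) (by linarith)

/-- The comparison constant `c_T = 2(#M_F^∞ + #T)`. [folklore] -/
theorem unitHt_le (x : Fˣ × Fˣ) (h1 : x.1 ∈ (T : Set (HeightOneSpectrum (𝓞 F))).unit F)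
    (h2 : x.2 ∈ (T : Set (HeightOneSpectrum (𝓞 F))).unit F) :
    unitHt F x ≤ 2 * (Fintype.card (InfinitePlace F) + T.card) * ‖unitLog F T x‖ := by
  simp only [unitHt, unitLog, Prod.norm_def]
  have e1 := logHeight₁_le_of_mem_unit T h1
  have e2 := logHeight₁_le_of_mem_unit T h2
  have hm1 : ‖logEmbedding T x.1‖ ≤ max ‖logEmbedding T x.1‖ ‖logEmbedding T x.2‖ := le_max_left _ _
  have hm2 : ‖logEmbedding T x.2‖ ≤ max ‖logEmbedding T x.1‖ ‖logEmbedding T x.2‖ := le_max_right _ _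
  have hc : (0 : ℝ) ≤ Fintype.card (InfinitePlace F) + T.card := by positivity
  nlinarith [mul_le_mul_of_nonneg_left hm1 hc, mul_le_mul_of_nonneg_left hm2 hc]

/-- Twisting: `Λ(y₁x₁^{-k}, y₂x₂^{-k}) = Λ y - k Λ x`. [folklore] -/
theorem unitLog_twist (x y : Fˣ × Fˣ) (k : ℕ) :
    unitLog F T (y.1 * (x.1 ^ k)⁻¹, y.2 * (x.2 ^ k)⁻¹) = unitLog F T y - (k : ℝ) • unitLog F T x := by
  simp only [unitLog, logEmbedding_mul_pow_inv, Prod.smul_mk, Prod.mk_sub_mk]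

/-- **Northcott for solutions**: the solutions of bounded height form a finite set (the first
coordinate determines the solution and has bounded height; Mathlib
`NumberField.finite_setOf_logHeight₁_le`). [cite: BombieriGubler2006, 5.2.18 (small solutions)] -/
theorem finite_unitSol_ht_le (B : ℝ) : {x ∈ unitSol F T | unitHt F x ≤ B}.Finite := by
  have hfin := NumberField.finite_setOf_logHeight₁_le (K := F) B
  refine Set.Finite.of_finite_image (f := fun x : Fˣ × Fˣ => (x.1 : F)) ?_ ?_
  · refine hfin.subset ?_
    rintro _ ⟨x, ⟨-, hB⟩, rfl⟩
    exact le_trans (le_add_of_nonneg_right (zero_le_logHeight₁ _)) hB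
  · rintro x ⟨⟨-, -, hx⟩, -⟩ y ⟨⟨-, -, hy⟩, -⟩ hxy
    simp only at hxy
    have h1 : x.1 = y.1 := Units.ext hxy
    have h2 : x.2 = y.2 := Units.ext (by
      have : (x.2 : F) = 1 - x.1 := by rw [← hx]; ring
      rw [this, hxy, ← hy]; ring)
    exact Prod.ext h1 h2

/-! ## The key inequality (5.12) for the embedding -/

/-- `h((1 : x₁ : x₂)) ≥ ½ ĥ(x)`: the projective height of the point dominates the heights of its
coordinates (B–G p. 137: "`½ĥ(x) ≤ max(h(x₁), h(x₂)) ≤ h(x) ≤ ĥ(x)`"). [cite: BombieriGubler2006, 5.2.16] -/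
theorem unitHt_le_two_mul_logHeight (x₁ x₂ : F) :
    logHeight₁ x₁ + logHeight₁ x₂ ≤ 2 * logHeight ![(1 : F), x₁, x₂] := by
  have key : ∀ a : F, logHeight₁ a ≤ logHeight ![(1 : F), x₁, x₂] →
      True := fun _ _ => trivial
  have h1 : logHeight₁ x₁ ≤ logHeight ![(1 : F), x₁, x₂] := by
    rw [logHeight₁_eq_logHeight]
    have : (![x₁, 1] : Fin 2 → F) = ![(1 : F), x₁, x₂] ∘ ![1, 0] := by
      ext i; fin_cases i <;> rfl
    rw [this, logHeight_eq_log_mulHeight, logHeight_eq_log_mulHeight]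
    exact Real.log_le_log (mulHeight_pos _) (mulHeight_comp_le _ _)
  have h2 : logHeight₁ x₂ ≤ logHeight ![(1 : F), x₁, x₂] := by
    rw [logHeight₁_eq_logHeight]
    have : (![x₂, 1] : Fin 2 → F) = ![(1 : F), x₁, x₂] ∘ ![2, 0] := by
      ext i; fin_cases i <;> rfl
    rw [this, logHeight_eq_log_mulHeight, logHeight_eq_log_mulHeight]
    exact Real.log_le_log (mulHeight_pos _) (mulHeight_comp_le _ _)
  linarith

/-- `h((a : b : 1)) ≤ h(a) + h(b)`: by the Segre identity `H(![a,1] ⊗ ![b,1]) = H(a) H(b)`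
(Mathlib `Height.mulHeight_fun_mul_eq`) and monotonicity under sub-tuples.
[cite: BombieriGubler2006, 5.2.16] -/
theorem logHeight_triple_le (a b : F) : logHeight ![a, b, 1] ≤ logHeight₁ a + logHeight₁ b := by
  have hx : (![a, 1] : Fin 2 → F) ≠ 0 := fun h => by simpa using congrFun h 1
  have hy : (![b, 1] : Fin 2 → F) ≠ 0 := fun h => by simpa using congrFun h 1
  have hprod := logHeight_fun_mul_eq hx hy
  -- `![a, b, 1]` is a sub-tuple of the product tuple `(a b, a, b, 1)`
  have hsub : (![a, b, 1] : Fin 3 → F) =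
      (fun p : Fin 2 × Fin 2 => ![a, 1] p.1 * ![b, 1] p.2) ∘ ![(0, 1), (1, 0), (1, 1)] := by
    ext i; fin_cases i <;> simp
  rw [logHeight₁_eq_logHeight, logHeight₁_eq_logHeight, ← hprod, hsub, logHeight_eq_log_mulHeight,
    logHeight_eq_log_mulHeight]
  exact Real.log_le_log (mulHeight_pos _) (mulHeight_comp_le _ _)

/-- **The inequality (5.12) for `T`-unit solutions**: for solutions `x, y` of `u + v = 1` and
`n ≥ 2`, `‖Λx‖ ≤ α + β/(n-1) · ‖Λy - 2n Λx‖` with `α = 120 log 2 · totalWeight F` and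
`β = 8(#M_F^∞ + #T)` (B–G: `‖u‖ ≤ 2κ + (2/(n-1)) ‖v - 2nu‖`; from Lemma 5.2.14 and the
comparisons `½ĥ ≤ h ≤ ĥ`, here `key_height_inequality` and the quasi-isometry of `Λ`).
[cite: BombieriGubler2006, 5.2.16 (5.12)] -/
theorem norm_unitLog_le_gap {x y : Fˣ × Fˣ} (hx : x ∈ unitSol F T) (hy : y ∈ unitSol F T)
    (n : ℕ) (hn : 2 ≤ n) :
    ‖unitLog F T x‖ ≤ 120 * Real.log 2 * totalWeight F +
      (8 * (Fintype.card (InfinitePlace F) + T.card)) / (n - 1) *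
        ‖unitLog F T y - (2 * n : ℝ) • unitLog F T x‖ := by
  obtain ⟨hx1, hx2, hxe⟩ := hx
  obtain ⟨hy1, hy2, hye⟩ := hy
  set c : ℝ := Fintype.card (InfinitePlace F) + T.card with hc
  have hc0 : 0 ≤ c := by positivity
  -- the key height inequality
  have hkey := key_height_inequality (K := F) n hn hxe hye x.1.ne_zero x.2.ne_zero y.2.ne_zero
  -- the twisted pair and its embedding
  set z : Fˣ × Fˣ := (y.1 * (x.1 ^ (2 * n))⁻¹, y.2 * (x.2 ^ (2 * n))⁻¹) with hz
  have hz1 : z.1 ∈ (T : Set (HeightOneSpectrum (𝓞 F))).unit F :=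
    mul_mem hy1 (inv_mem (pow_mem hx1 _))
  have hz2 : z.2 ∈ (T : Set (HeightOneSpectrum (𝓞 F))).unit F :=
    mul_mem hy2 (inv_mem (pow_mem hx2 _))
  have hzlog : unitLog F T z = unitLog F T y - (2 * n : ℝ) • unitLog F T x := by
    rw [hz, unitLog_twist]; push_cast; rfl
  have htwist : logHeight ![(y.1 : F) / (x.1 : F) ^ (2 * n), (y.2 : F) / (x.2 : F) ^ (2 * n), 1] ≤
      unitHt F z := by
    have e1 : (y.1 : F) / (x.1 : F) ^ (2 * n) = (z.1 : F) := by
      simp [hz, div_eq_mul_inv]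
    have e2 : (y.2 : F) / (x.2 : F) ^ (2 * n) = (z.2 : F) := by
      simp [hz, div_eq_mul_inv]
    rw [e1, e2]
    exact logHeight_triple_le _ _
  have hzht : unitHt F z ≤ 2 * c * ‖unitLog F T z‖ := unitHt_le z hz1 hz2
  have hxht : unitHt F x ≤ 2 * logHeight ![(1 : F), x.1, x.2] := unitHt_le_two_mul_logHeight _ _
  have hxlog : ‖unitLog F T x‖ ≤ 2 * unitHt F x := norm_unitLog_le x
  rw [hzlog] at hzht
  -- arithmetic
  have hn1 : (1 : ℝ) ≤ (n : ℝ) - 1 := by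
    have : (2 : ℝ) ≤ n := by exact_mod_cast hn
    linarith
  have hn0 : (0 : ℝ) < (n : ℝ) - 1 := by linarith
  set N := ‖unitLog F T y - (2 * n : ℝ) • unitLog F T x‖ with hN
  have hN0 : 0 ≤ N := norm_nonneg _
  set C := 15 * Real.log 2 * totalWeight F with hC
  have hC0 : 0 ≤ C := by rw [hC]; positivity
  -- `(n-1) · ‖Λx‖/4 ≤ C n + 2c N`
  have main : ((n : ℝ) - 1) * ‖unitLog F T x‖ ≤ 4 * C * n + 8 * c * N := by
    have h4 : ((n : ℝ) - 1) * ‖unitLog F T x‖ ≤ (n - 1) * (4 * logHeight ![(1 : F), x.1, x.2]) :=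
      mul_le_mul_of_nonneg_left (by linarith) hn0.le
    nlinarith [hkey, htwist, hzht]
  rw [show 120 * Real.log 2 * (totalWeight F : ℝ) = 8 * C by rw [hC]; ring, div_mul_eq_mul_div]
  refine le_of_mul_le_mul_right ?_ hn0
  rw [add_mul, div_mul_cancel₀ _ hn0.ne']
  nlinarith [main, hC0, hn1]

/-! ## Finiteness -/

/-- **Finitely many solutions in `T`-units** (B–G Thm. 5.2.1, finiteness): the set
`unitSol F T` of pairs of `T`-units with `u + v = 1` is finite. Large solutions
(`‖Λx‖ > 2α`) whose directions `Λx/‖Λx‖` lie in a fixed ball of radius `1/(32β)` have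
`‖Λ‖`, hence height, bounded in terms of any one of them (Lemma 5.2.17, `norm_le_of_cone`), so
are finitely many by Northcott; finitely many such balls cover the compact unit sphere; and small
solutions are finitely many by Northcott. [cite: BombieriGubler2006, Thm. 5.2.1] -/
theorem finite_unitSol : (unitSol F T).Finite := by
  set α : ℝ := 120 * Real.log 2 * totalWeight F with hα
  set c : ℝ := Fintype.card (InfinitePlace F) + T.card with hc
  set β : ℝ := 8 * c with hβ
  have hα0 : 0 ≤ α := by rw [hα]; positivity
  have hc1 : 1 ≤ c := by
    rw [hc]
    have : 1 ≤ Fintype.card (InfinitePlace F) := Fintype.card_pos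
    have : (1 : ℝ) ≤ Fintype.card (InfinitePlace F) := by exact_mod_cast this
    linarith [(Nat.cast_nonneg T.card : (0 : ℝ) ≤ T.card)]
  have hβ0 : 0 < β := by rw [hβ]; linarith
  set ε : ℝ := 1 / (16 * β) with hε
  have hε0 : 0 < ε := by rw [hε]; positivity
  by_contra hinf
  -- large solutions are infinitely many
  set Large := {x ∈ unitSol F T | 2 * α < ‖unitLog F T x‖} with hLarge
  have hLinf : Large.Infinite := by
    intro hLfin
    apply hinf
    have hsmall : {x ∈ unitSol F T | ‖unitLog F T x‖ ≤ 2 * α}.Finite := by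
      refine (finite_unitSol_ht_le (F := F) (T := T) (2 * c * (2 * α))).subset ?_
      rintro x ⟨hx, hxn⟩
      refine ⟨hx, (unitHt_le x hx.1 hx.2.1).trans ?_⟩
      rw [← hc]
      nlinarith
    refine (hLfin.union hsmall).subset fun x hx => ?_
    rcases lt_or_ge (2 * α) ‖unitLog F T x‖ with h | h
    · exact Or.inl ⟨hx, h⟩
    · exact Or.inr ⟨hx, h⟩
  -- cover the unit sphere of `W` by finitely many small balls
  obtain ⟨A, hAfin, hAcov⟩ := Metric.totallyBounded_iff.mp
    (isCompact_sphere (0 : (InfinitePlace F ⊕ ↥T → ℝ) × (InfinitePlace F ⊕ ↥T → ℝ)) 1).totallyBounded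
    (ε / 2) (by positivity)
  -- directions of large solutions
  set ν : Fˣ × Fˣ → (InfinitePlace F ⊕ ↥T → ℝ) × (InfinitePlace F ⊕ ↥T → ℝ) :=
    fun x => ‖unitLog F T x‖⁻¹ • unitLog F T x with hν
  have hνmem : ∀ x ∈ Large, ν x ∈ Metric.sphere (0 : (InfinitePlace F ⊕ ↥T → ℝ) ×
      (InfinitePlace F ⊕ ↥T → ℝ)) 1 := by
    rintro x ⟨-, hx⟩
    have hpos : 0 < ‖unitLog F T x‖ := by linarith
    rw [mem_sphere_zero_iff_norm, hν]
    simp only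
    rw [norm_smul, norm_inv, norm_norm, inv_mul_cancel₀ hpos.ne']
  -- pigeonhole: some ball contains the directions of infinitely many large solutions
  have hcover : Large ⊆ ⋃ a ∈ A, {x ∈ Large | ν x ∈ Metric.ball a (ε / 2)} := by
    intro x hx
    have := hAcov (hνmem x hx)
    simp only [Set.mem_iUnion] at this ⊢
    obtain ⟨a, ha, hball⟩ := this
    exact ⟨a, ha, hx, hball⟩
  obtain ⟨a, haA, hainf⟩ : ∃ a ∈ A, {x ∈ Large | ν x ∈ Metric.ball a (ε / 2)}.Infinite := by
    by_contra h
    exact hLinf ((hAfin.biUnion fun a ha =>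
      Set.not_infinite.mp fun hinf' => h ⟨a, ha, hinf'⟩).subset hcover)
  -- fix one large solution in that cone; all others in the cone have comparable norm
  obtain ⟨x₀, hx₀L, hx₀a⟩ := hainf.nonempty
  set M : ℝ := 2 * (⌈8 * β⌉₊ + 2) * ‖unitLog F T x₀‖ with hM
  have hx₀pos : 0 < ‖unitLog F T x₀‖ := by have := hx₀L.2; linarith
  have hbound : ∀ x ∈ {x ∈ Large | ν x ∈ Metric.ball a (ε / 2)}, ‖unitLog F T x‖ ≤ M := by
    rintro x ⟨hxL, hxa⟩
    have hM1 : ‖unitLog F T x₀‖ ≤ M := by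
      rw [hM]
      have : (1 : ℝ) ≤ 2 * (⌈8 * β⌉₊ + 2) := by
        have := (Nat.cast_nonneg ⌈8 * β⌉₊ : (0 : ℝ) ≤ ⌈8 * β⌉₊); linarith
      nlinarith
    rcases le_or_gt ‖unitLog F T x‖ ‖unitLog F T x₀‖ with hle | hgt
    · exact hle.trans hM1
    · refine norm_le_of_cone hα0 hβ0 (fun n hn => ?_) ?_ hx₀L.2 hgt.le
      · have h := norm_unitLog_le_gap hx₀L.1 hxL.1 n hn
        rw [← hc, ← hβ, ← hα] at h
        exact h
      · calc ‖‖unitLog F T x‖⁻¹ • unitLog F T x - ‖unitLog F T x₀‖⁻¹ • unitLog F T x₀‖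
            = dist (ν x) (ν x₀) := by rw [dist_eq_norm]
          _ ≤ dist (ν x) a + dist a (ν x₀) := dist_triangle _ _ _
          _ ≤ ε / 2 + ε / 2 := by
              refine add_le_add (le_of_lt hxa) ?_
              rw [dist_comm]; exact le_of_lt hx₀a
          _ = 1 / (16 * β) := by rw [hε]; ring
  -- hence bounded height, hence finite: contradiction
  refine hainf ((finite_unitSol_ht_le (F := F) (T := T) (2 * c * M)).subset ?_)
  rintro x hx
  refine ⟨hx.1.1, (unitHt_le x hx.1.1.1 hx.1.1.2.1).trans ?_⟩
  rw [← hc]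
  have := hbound x hx
  nlinarith

/-- **The unit equation has only finitely many solutions** (Siegel, Mahler, Lang; Silverman AEC
Thm. IX.4.1 with `a = b = 1`; Bombieri–Gubler Thm. 5.2.1): for a number field `F` and a finite set
`T` of finite places, only finitely many `T`-units `u` admit a `T`-unit `v` with `u + v = 1`.
This is the hypothesis `U` of `finite_integer_sq_eq_cubic_of_unitEquation`
(`SiegelCubicReduction.lean`), proved here via the Beukers–Schlickewei Padé method
(`PadeOneSubPow.lean`, `UnitEquationHeightInequality.lean`), the logarithmic embedding
(`UnitEquationLogEmbedding.lean`), Lemma 5.2.17 and Northcott. [cite: BombieriGubler2006, Thm. 5.2.1] -/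
theorem finite_unitEquation (F : Type*) [Field F] [NumberField F]
    (T : Set (HeightOneSpectrum (𝓞 F))) (hT : T.Finite) :
    {u : Fˣ | u ∈ T.unit F ∧ ∃ v : Fˣ, v ∈ T.unit F ∧ (u : F) + v = 1}.Finite := by
  have h := (finite_unitSol (F := F) (T := hT.toFinset)).image Prod.fst
  refine h.subset ?_
  rintro u ⟨hu, v, hv, huv⟩
  refine ⟨(u, v), ⟨?_, ?_, huv⟩, rfl⟩
  · rwa [Set.Finite.coe_toFinset]
  · rwa [Set.Finite.coe_toFinset]

end Literature.NumberTheory.DiophantineGeometry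

end
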